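import Summits.Parity.BatemanHorn.Theorems.AlmostPrimeZerosSystemMomentDeficitK1OfRoughClassDeficitAux

/-!
# Crux `SystemMomentDeficit` (stmt-Parity-11326), line `Ideator3Sketch`: K1 from the rough-class deficit

The bridge of the reshaped skeleton: the decorrelated covariance bound K1
(`stub_decorrelatedCovarianceBound`, `Cov(W, N) ≥ −C`) follows from the per-prime-power,
one-sided ROUGH-CLASS DEFICIT bound RCD (`stub_roughClassDeficit`):
for every prime power `q ∈ PP(y)`, `y = ⌊x^{1/4}⌋`,
`Σᵢ Cov(1_{q ∣ fᵢ(n)⁺ ≠ 0}, N) ≥ −C Λ(q)/(q log x)`.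

Proof.  `W = Σ_{q ∈ PP(y)} w_q Σᵢ 1_{i,q}` with `w_q = 1 − 2Λ(q)/log y ∈ [−1, 1]`, so
`Cov(W, N) = Σ_q w_q Cov_q`, `Cov_q = Σᵢ Cov(1_{i,q}, N)`.  Where `w_q ≥ 0` use RCD; where `w_q < 0`
(`2Λ(q) > log y`) use `Cov_q ≤ Σᵢ E(1_{i,q} N) ≤ K Σᵢ E 1_{i,q} ≤ 2kKD/q ≤ 4kKD Λ(q)/(q log y)`
(`0 ≤ N ≤ K`, root-class bound `E 1_{i,q} ≤ 2D/q`).  Summing, `Σ_{q ∈ PP(y)} Λ(q)/q ≤ 2 log y + 2`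
(Mertens I) gives `Cov(W, N) ≥ −(3|C| + 24 kKD)`.  The finite algebra (`weightedCov_expand`), the
Mertens sum (`sum_PP_vonMangoldt_div_le`) and the termwise inequality (`weightedTerm_ge`) are in the
auxiliary file `…K1OfRoughClassDeficitAux.lean`.

Notation (docstrings only).  `Y = x + 1`, `E g = Y⁻¹ Σ_{0 ≤ n ≤ x} g(n)`, `PP(z)` = primes `≤ z` ∪
prime squares `≤ z`, `1_{i,q}(n) = [q ∣ fᵢ(n)⁺ ≠ 0]`,
`N(n) = s_f(n) − Σᵢ #{q ∈ PP(x) : q ∣ fᵢ(n)⁺ ≠ 0}` (capped count of prime(-square) factors `> x`),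
`D = Σᵢ deg fᵢ · Mᵢ`, `K = Σᵢ 2(deg fᵢ + H(fᵢ))`.  Everything is [folklore].
-/

namespace Summit.Parity.BatemanHorn.Cruxes.SystemMomentDeficit.Ideator3Sketch

open scoped BigOperators
open Finset Polynomial
open Literature.NumberTheory.Sieve
open Summit.Parity.BatemanHorn.Theorems.AlmostPrimeZeros.SystemMertens

/-- **K1 from the rough-class deficit bound** (bridge of the reshaped skeleton of line
`Ideator3Sketch`).  If for every Bateman–Horn system `f` there is `C` with
`Σᵢ [E(1_{i,q} N) − E 1_{i,q} · E N] ≥ −C Λ(q)/(q log x)` for all `x ≥ 16` and all prime powers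
`q ∈ PP(⌊x^{1/4}⌋)` (stub RCD), then the decorrelated covariance bound
`Cov(W, N) ≥ −C'` (stub K1, verbatim) holds for every Bateman–Horn system, with
`C' = 3|C| + 24 kKD`. -/
theorem decorrelatedCovarianceBound_of_roughClassDeficit :
    (∀ (k : ℕ) (f : Fin k → ℤ[X]), IsBatemanHornSystem f → ∃ C : ℝ, ∀ x : ℕ, 16 ≤ x →
      ∀ q ∈ (Nat.primesLE (Nat.sqrt (Nat.sqrt x)) ∪
          ((Nat.primesLE (Nat.sqrt (Nat.sqrt x))).filter
            (fun p => p ^ 2 ≤ Nat.sqrt (Nat.sqrt x))).image (fun p => p ^ 2)),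
        -(C * ArithmeticFunction.vonMangoldt q / ((q : ℝ) * Real.log x)) ≤
          ∑ i, ((∑ n ∈ (Finset.range (x + 1)).filter
                  (fun n : ℕ => q ∣ ((f i).eval (n : ℤ)).toNat ∧ ((f i).eval (n : ℤ)).toNat ≠ 0),
                (((∑ j, (((f j).eval (n : ℤ)).toNat.factorization.sum fun _ v => min v 2) : ℕ) : ℝ) -
                  ((∑ j, #((Nat.primesLE x ∪ ((Nat.primesLE x).filter (fun p => p ^ 2 ≤ x)).image
                      (fun p => p ^ 2)).filter
                    (fun r => r ∣ ((f j).eval (n : ℤ)).toNat ∧ ((f j).eval (n : ℤ)).toNat ≠ 0)) : ℕ) :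
                    ℝ))) /
                ((x : ℝ) + 1) -
            (#((Finset.range (x + 1)).filter
                (fun n : ℕ => q ∣ ((f i).eval (n : ℤ)).toNat ∧ ((f i).eval (n : ℤ)).toNat ≠ 0)) : ℝ) /
                ((x : ℝ) + 1) *
              ((∑ n ∈ Finset.range (x + 1),
                  (((∑ j, (((f j).eval (n : ℤ)).toNat.factorization.sum fun _ v => min v 2) : ℕ) : ℝ) -
                    ((∑ j, #((Nat.primesLE x ∪ ((Nat.primesLE x).filter (fun p => p ^ 2 ≤ x)).image
                        (fun p => p ^ 2)).filter
                      (fun r => r ∣ ((f j).eval (n : ℤ)).toNat ∧ ((f j).eval (n : ℤ)).toNat ≠ 0)) : ℕ) :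
                      ℝ))) /
                ((x : ℝ) + 1)))) →
    ∀ (k : ℕ) (f : Fin k → ℤ[X]), IsBatemanHornSystem f → ∃ C : ℝ, ∀ x : ℕ, 16 ≤ x →
      -C ≤
        (∑ n ∈ Finset.range (x + 1),
            (∑ i, ∑ q ∈ (Nat.primesLE (Nat.sqrt (Nat.sqrt x)) ∪
                ((Nat.primesLE (Nat.sqrt (Nat.sqrt x))).filter
                  (fun p => p ^ 2 ≤ Nat.sqrt (Nat.sqrt x))).image (fun p => p ^ 2)).filter
                (fun q => q ∣ ((f i).eval (n : ℤ)).toNat ∧ ((f i).eval (n : ℤ)).toNat ≠ 0),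
              (1 - 2 * ArithmeticFunction.vonMangoldt q / Real.log (Nat.sqrt (Nat.sqrt x)))) *
            (((∑ i, (((f i).eval (n : ℤ)).toNat.factorization.sum fun _ v => min v 2) : ℕ) : ℝ) -
              ((∑ i, #((Nat.primesLE x ∪ ((Nat.primesLE x).filter (fun p => p ^ 2 ≤ x)).image
                  (fun p => p ^ 2)).filter
                (fun q => q ∣ ((f i).eval (n : ℤ)).toNat ∧ ((f i).eval (n : ℤ)).toNat ≠ 0)) : ℕ) : ℝ))) /
            ((x : ℝ) + 1) -
          (∑ n ∈ Finset.range (x + 1),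
              (∑ i, ∑ q ∈ (Nat.primesLE (Nat.sqrt (Nat.sqrt x)) ∪
                  ((Nat.primesLE (Nat.sqrt (Nat.sqrt x))).filter
                    (fun p => p ^ 2 ≤ Nat.sqrt (Nat.sqrt x))).image (fun p => p ^ 2)).filter
                  (fun q => q ∣ ((f i).eval (n : ℤ)).toNat ∧ ((f i).eval (n : ℤ)).toNat ≠ 0),
                (1 - 2 * ArithmeticFunction.vonMangoldt q / Real.log (Nat.sqrt (Nat.sqrt x))))) /
              ((x : ℝ) + 1) *
            ((∑ n ∈ Finset.range (x + 1),
                (((∑ i, (((f i).eval (n : ℤ)).toNat.factorization.sum fun _ v => min v 2) : ℕ) : ℝ) -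
                  ((∑ i, #((Nat.primesLE x ∪ ((Nat.primesLE x).filter (fun p => p ^ 2 ≤ x)).image
                      (fun p => p ^ 2)).filter
                    (fun q => q ∣ ((f i).eval (n : ℤ)).toNat ∧ ((f i).eval (n : ℤ)).toNat ≠ 0)) : ℕ) :
                    ℝ))) /
              ((x : ℝ) + 1)) := by
  intro hRCD k f hf
  classical
  obtain ⟨C, hC⟩ := hRCD k f hf
  choose M hM1 hM hρ using fun i => exists_rootCount_primePow_le (hf.irreducible i) (hf.natDegree_pos i)
  set D : ℝ := ∑ i, ((f i).natDegree : ℝ) * (M i : ℝ) with hD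
  set K : ℝ := ∑ i, (2 * (((f i).natDegree : ℝ) +
    ((∑ j ∈ range ((f i).natDegree + 1), ((f i).coeff j).natAbs : ℕ) : ℝ))) with hK
  have hD0 : 0 ≤ D := sum_nonneg fun i _ => by positivity
  have hK0 : 0 ≤ K := sum_nonneg fun i _ => by positivity
  clear_value D K
  have hkKD0 : (0 : ℝ) ≤ k * K * D := mul_nonneg (mul_nonneg (Nat.cast_nonneg k) hK0) hD0
  refine ⟨3 * |C| + 24 * k * K * D, fun x hx => ?_⟩
  have hCx := hC x hx
  /- ### parameters at `x` -/
  have hx1 : 1 ≤ x := by omega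
  have hz4 : 4 ≤ Nat.sqrt x := Nat.le_sqrt.2 (by omega)
  set y : ℕ := Nat.sqrt (Nat.sqrt x) with hy
  have hy2 : 2 ≤ y := Nat.le_sqrt.2 (by omega)
  have hyx : y ≤ x := (Nat.sqrt_le_self _).trans (Nat.sqrt_le_self x)
  have hY0 : (0 : ℝ) < (x : ℝ) + 1 := by positivity
  -- logarithms
  have hlog2 : (1 : ℝ) / 2 < Real.log 2 := by
    have := Real.log_two_gt_d9
    linarith
  have hlogy : Real.log 2 ≤ Real.log y := Real.log_le_log (by norm_num) (by exact_mod_cast hy2)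
  have hlogy0 : 0 < Real.log y := by linarith
  have hlogx : 2 < Real.log x := by
    have h16 : Real.log 16 = 4 * Real.log 2 := by
      rw [show (16 : ℝ) = 2 ^ 4 by norm_num, Real.log_pow]; push_cast; ring
    have : Real.log 16 ≤ Real.log x := Real.log_le_log (by norm_num) (by exact_mod_cast hx)
    linarith
  have hlogx0 : 0 < Real.log x := by linarith
  have hlogyx : Real.log y ≤ Real.log x :=
    Real.log_le_log (by exact_mod_cast (show 0 < y by omega)) (by exact_mod_cast hyx)
  /- ### the index sets `Py ⊆ Px` -/
  have hPyx : (Nat.primesLE y ∪ ((Nat.primesLE y).filter (fun p => p ^ 2 ≤ y)).image (fun p => p ^ 2)) ⊆ (Nat.primesLE x ∪ ((Nat.primesLE x).filter (fun p => p ^ 2 ≤ x)).image (fun p => p ^ 2)) := PP_mono hyx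
  -- Mertens I over `PP(y)`: `Σ Λ(q)/q ≤ 2 log y + 2`
  have hsum3 := sum_PP_vonMangoldt_div_le y
  /- ### freeze `Px = PP(x)`, `Py = PP(y)` -/
  set Px : Finset ℕ := (Nat.primesLE x ∪ ((Nat.primesLE x).filter (fun p => p ^ 2 ≤ x)).image (fun p => p ^ 2)) with hPx
  set Py : Finset ℕ := (Nat.primesLE y ∪ ((Nat.primesLE y).filter (fun p => p ^ 2 ≤ y)).image (fun p => p ^ 2)) with hPy
  have hmemPy : ∀ q ∈ Py, IsPrimePow q ∧ 2 ≤ q ∧ q ≤ y := fun q hq => by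
    rw [hPy] at hq
    exact isPrimePow_and_le_of_mem_PP hq
  have hmemPx : ∀ q ∈ Px, IsPrimePow q ∧ 2 ≤ q ∧ q ≤ x := fun q hq => by
    rw [hPx] at hq
    exact isPrimePow_and_le_of_mem_PP hq
  have hcapx : ∀ m : ℕ, #((Px).filter (fun q => q ∣ m ∧ m ≠ 0)) ≤
      (m.factorization.sum fun _ v => min v 2) := fun m => by
    rw [hPx]; exact card_PP_filter_le_capped x m
  have hcapx' : ∀ n : ℕ, n ≤ x → ∀ i : Fin k,
      (((f i).eval (n : ℤ)).toNat.factorization.sum fun _ v => min v 2) ≤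
        #((Px).filter (fun q => q ∣ ((f i).eval (n : ℤ)).toNat ∧ ((f i).eval (n : ℤ)).toNat ≠ 0)) +
          2 * ((f i).natDegree + ∑ j ∈ range ((f i).natDegree + 1), ((f i).coeff j).natAbs) :=
    fun n hn i => by rw [hPx]; exact capped_le_card_PP_filter_add (f i) hx1 hn
  clear_value Px Py
  /- ### the indicators `Zf (i, q)` -/
  set Zf : Fin k × ℕ → ℕ → ℝ := fun t n =>
    if t.2 ∣ ((f t.1).eval (n : ℤ)).toNat ∧ ((f t.1).eval (n : ℤ)).toNat ≠ 0 then 1 else 0 with hZf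
  have hZf01 : ∀ t n, Zf t n = 0 ∨ Zf t n = 1 := fun t n => by
    simp only [hZf]; split_ifs <;> simp
  have hZf0 : ∀ t n, 0 ≤ Zf t n := fun t n => by rcases hZf01 t n with h | h <;> simp [h]
  have hZsum : ∀ t, ∑ n ∈ range (x + 1), Zf t n =
      (#((range (x + 1)).filter fun n : ℕ =>
        t.2 ∣ ((f t.1).eval (n : ℤ)).toNat ∧ ((f t.1).eval (n : ℤ)).toNat ≠ 0) : ℝ) := fun t => by
    simp only [hZf]
    rw [sum_boole]
  -- root-class bound for the means: `E 1_{i,q} ≤ 2D/q` for `q ∈ Px`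
  have he : ∀ t : Fin k × ℕ, t.2 ∈ Px →
      (∑ n ∈ range (x + 1), Zf t n) / ((x : ℝ) + 1) ≤ 2 * D / (t.2 : ℝ) := by
    rintro ⟨i, q⟩ hq
    obtain ⟨hpp, hq2, hqx⟩ := hmemPx q hq
    have hq0 : 0 < q := by omega
    have hqR : (0 : ℝ) < q := by exact_mod_cast hq0
    rw [hZsum]
    refine (card_filter_dvd_toNat_div_le (f i) hq0 x).trans ?_
    obtain ⟨p, a, hp, ha, rfl⟩ := (isPrimePow_nat_iff q).1 hpp
    have hρD : (polyRootCountMod ![f i] (p ^ a) : ℝ) ≤ D := by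
      have h1 : (polyRootCountMod ![f i] (p ^ a) : ℝ) ≤ ((f i).natDegree : ℝ) * (M i : ℝ) := by
        exact_mod_cast hM i p hp a
      rw [hD]
      exact h1.trans (single_le_sum (f := fun i => ((f i).natDegree : ℝ) * (M i : ℝ))
        (fun i _ => by positivity) (mem_univ i))
    have hY' : 1 / ((x : ℝ) + 1) ≤ 1 / ((p ^ a : ℕ) : ℝ) :=
      one_div_le_one_div_of_le hqR (by exact_mod_cast Nat.le_succ_of_le hqx)
    calc (polyRootCountMod ![f i] (p ^ a) : ℝ) * (1 / ((p ^ a : ℕ) : ℝ) + 1 / ((x : ℝ) + 1))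
        ≤ D * (1 / ((p ^ a : ℕ) : ℝ) + 1 / ((x : ℝ) + 1)) :=
          mul_le_mul_of_nonneg_right hρD (by positivity)
      _ ≤ D * (1 / ((p ^ a : ℕ) : ℝ) + 1 / ((p ^ a : ℕ) : ℝ)) :=
          mul_le_mul_of_nonneg_left (add_le_add_right hY' _) hD0
      _ = 2 * D / ((p ^ a : ℕ) : ℝ) := by ring
  /- ### the rough count `N`, `0 ≤ N ≤ K` -/
  obtain ⟨N, hN⟩ : ∃ N : ℕ → ℝ, N = fun n : ℕ =>
      (((∑ i, (((f i).eval (n : ℤ)).toNat.factorization.sum fun _ v => min v 2) : ℕ) : ℝ) -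
        ((∑ i, #((Px).filter
          (fun q => q ∣ ((f i).eval (n : ℤ)).toNat ∧ ((f i).eval (n : ℤ)).toNat ≠ 0)) : ℕ) : ℝ)) :=
    ⟨_, rfl⟩
  have hN0 : ∀ n, 0 ≤ N n := fun n => by
    rw [hN]
    simp only [sub_nonneg]
    exact_mod_cast sum_le_sum fun i _ => hcapx _
  have hNK : ∀ n ∈ range (x + 1), N n ≤ K := fun n hn => by
    have hnx : n ≤ x := Nat.lt_succ_iff.1 (mem_range.1 hn)
    rw [hN, hK]
    simp only
    have h1 : ((∑ i, (((f i).eval (n : ℤ)).toNat.factorization.sum fun _ v => min v 2) : ℕ) : ℝ) ≤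
        ((∑ i, (#((Px).filter
          (fun q => q ∣ ((f i).eval (n : ℤ)).toNat ∧ ((f i).eval (n : ℤ)).toNat ≠ 0)) +
          2 * ((f i).natDegree + ∑ j ∈ range ((f i).natDegree + 1), ((f i).coeff j).natAbs)) : ℕ) : ℝ) := by
      exact_mod_cast sum_le_sum fun i _ => hcapx' n hnx i
    push_cast at h1 ⊢
    rw [sum_add_distrib] at h1
    linarith
  have hEN0 : 0 ≤ (∑ n ∈ range (x + 1), N n) / ((x : ℝ) + 1) :=
    div_nonneg (sum_nonneg fun n _ => hN0 n) hY0.le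
  -- `E(1_{i,q} N) ≤ K · E 1_{i,q}`
  have hZN : ∀ t, (∑ n ∈ range (x + 1), Zf t n * N n) / ((x : ℝ) + 1) ≤
      K * ((∑ n ∈ range (x + 1), Zf t n) / ((x : ℝ) + 1)) := fun t => by
    rw [mul_div_assoc', div_le_div_iff_of_pos_right hY0, mul_sum]
    refine sum_le_sum fun n hn => ?_
    rw [mul_comm K]
    exact mul_le_mul_of_nonneg_left (hNK n hn) (hZf0 t n)
  /- ### the per-`q` covariance `Cov_q` and its two bounds -/
  obtain ⟨cov, hcov⟩ : ∃ cov : ℕ → ℝ, cov = fun q : ℕ => ∑ i,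
      ((∑ n ∈ range (x + 1), Zf (i, q) n * N n) / ((x : ℝ) + 1) -
        (∑ n ∈ range (x + 1), Zf (i, q) n) / ((x : ℝ) + 1) *
          ((∑ n ∈ range (x + 1), N n) / ((x : ℝ) + 1))) := ⟨_, rfl⟩
  -- RCD at `x`, in `Zf`-form
  have hRCDq : ∀ q ∈ Py,
      -(C * ArithmeticFunction.vonMangoldt q / ((q : ℝ) * Real.log x)) ≤ cov q := by
    intro q hq
    have h := hCx q hq
    have e1 : ∀ i : Fin k, (∑ n ∈ (range (x + 1)).filter
        (fun n : ℕ => q ∣ ((f i).eval (n : ℤ)).toNat ∧ ((f i).eval (n : ℤ)).toNat ≠ 0),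
          (((∑ j, (((f j).eval (n : ℤ)).toNat.factorization.sum fun _ v => min v 2) : ℕ) : ℝ) -
            ((∑ j, #((Px).filter
              (fun r => r ∣ ((f j).eval (n : ℤ)).toNat ∧ ((f j).eval (n : ℤ)).toNat ≠ 0)) : ℕ) : ℝ))) =
        ∑ n ∈ range (x + 1), Zf (i, q) n * N n := by
      intro i
      rw [sum_filter, hN]
      refine sum_congr rfl fun n _ => ?_
      simp only [hZf, ite_mul, one_mul, zero_mul]
    have e2 : ∀ i : Fin k, (#((range (x + 1)).filter fun n : ℕ =>
        q ∣ ((f i).eval (n : ℤ)).toNat ∧ ((f i).eval (n : ℤ)).toNat ≠ 0) : ℝ) =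
        ∑ n ∈ range (x + 1), Zf (i, q) n := fun i => (hZsum (i, q)).symm
    have e3 : (∑ n ∈ range (x + 1),
          (((∑ j, (((f j).eval (n : ℤ)).toNat.factorization.sum fun _ v => min v 2) : ℕ) : ℝ) -
            ((∑ j, #((Px).filter
              (fun r => r ∣ ((f j).eval (n : ℤ)).toNat ∧ ((f j).eval (n : ℤ)).toNat ≠ 0)) : ℕ) : ℝ))) =
        ∑ n ∈ range (x + 1), N n := by
      rw [hN]
    simp only [e1, e2, e3] at h
    rw [hcov]
    exact h
  -- upper bound `Cov_q ≤ 2kKD/q` for `q ∈ Py`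
  have hcov_le : ∀ q ∈ Py, cov q ≤ 2 * k * K * D / (q : ℝ) := by
    intro q hq
    have hqx : q ∈ Px := hPyx hq
    rw [hcov]
    simp only
    calc ∑ i, ((∑ n ∈ range (x + 1), Zf (i, q) n * N n) / ((x : ℝ) + 1) -
          (∑ n ∈ range (x + 1), Zf (i, q) n) / ((x : ℝ) + 1) *
            ((∑ n ∈ range (x + 1), N n) / ((x : ℝ) + 1)))
        ≤ ∑ _i : Fin k, K * (2 * D / (q : ℝ)) := by
          refine sum_le_sum fun i _ => ?_
          have h1 := hZN (i, q)
          have h2 : 0 ≤ (∑ n ∈ range (x + 1), Zf (i, q) n) / ((x : ℝ) + 1) *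
              ((∑ n ∈ range (x + 1), N n) / ((x : ℝ) + 1)) :=
            mul_nonneg (div_nonneg (sum_nonneg fun n _ => hZf0 _ n) hY0.le) hEN0
          have h3 : K * ((∑ n ∈ range (x + 1), Zf (i, q) n) / ((x : ℝ) + 1)) ≤
              K * (2 * D / (q : ℝ)) :=
            mul_le_mul_of_nonneg_left (he (i, q) hqx) hK0
          linarith
      _ = 2 * k * K * D / (q : ℝ) := by
          rw [sum_const, card_univ, Fintype.card_fin, nsmul_eq_mul]
          ring
  /- ### termwise: `w_q Cov_q ≥ −(|C|/log x + 4kKD/log y) Λ(q)/q` -/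
  have hterm : ∀ q ∈ Py,
      -(|C| / Real.log x * (ArithmeticFunction.vonMangoldt q / (q : ℝ)) +
          4 * k * K * D / Real.log y * (ArithmeticFunction.vonMangoldt q / (q : ℝ))) ≤
        (1 - 2 * ArithmeticFunction.vonMangoldt q / Real.log y) * cov q := by
    intro q hq
    obtain ⟨hpp, hq2, hqy⟩ := hmemPy q hq
    have hq0 : (0 : ℝ) < q := by exact_mod_cast (show 0 < q by omega)
    have hΛ0 : 0 ≤ ArithmeticFunction.vonMangoldt q := ArithmeticFunction.vonMangoldt_nonneg
    have hΛy : ArithmeticFunction.vonMangoldt q ≤ Real.log y :=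
      ArithmeticFunction.vonMangoldt_le_log.trans
        (Real.log_le_log hq0 (by exact_mod_cast hqy))
    have ht0 : 0 ≤ ArithmeticFunction.vonMangoldt q / (q : ℝ) := div_nonneg hΛ0 hq0.le
    have hAt : 0 ≤ |C| / Real.log x * (ArithmeticFunction.vonMangoldt q / (q : ℝ)) :=
      mul_nonneg (div_nonneg (abs_nonneg C) hlogx0.le) ht0
    -- the RCD lower bound with `|C|`, in product form
    have hlow : -(|C| / Real.log x * (ArithmeticFunction.vonMangoldt q / (q : ℝ))) ≤ cov q := by
      have h1 := hRCDq q hq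
      have h2 : C * ArithmeticFunction.vonMangoldt q / ((q : ℝ) * Real.log x) ≤
          |C| * ArithmeticFunction.vonMangoldt q / ((q : ℝ) * Real.log x) :=
        div_le_div_of_nonneg_right (mul_le_mul_of_nonneg_right (le_abs_self C) hΛ0)
          (mul_nonneg hq0.le hlogx0.le)
      have e : |C| * ArithmeticFunction.vonMangoldt q / ((q : ℝ) * Real.log x) =
          |C| / Real.log x * (ArithmeticFunction.vonMangoldt q / (q : ℝ)) := by
        field_simp
      linarith
    have hup : cov q ≤ 2 * k * K * D / (q : ℝ) := hcov_le q hq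
    have hU0 : 0 ≤ 2 * k * K * D / (q : ℝ) := div_nonneg (by linarith) hq0.le
    have hUB : 2 * k * K * D / (q : ℝ) * (2 * ArithmeticFunction.vonMangoldt q / Real.log y) ≤
        4 * k * K * D / Real.log y * (ArithmeticFunction.vonMangoldt q / (q : ℝ)) := by
      have e : 2 * k * K * D / (q : ℝ) * (2 * ArithmeticFunction.vonMangoldt q / Real.log y) =
          4 * k * K * D / Real.log y * (ArithmeticFunction.vonMangoldt q / (q : ℝ)) := by
        field_simp
        ring
      rw [e]
    exact weightedTerm_ge hΛ0 hΛy hlogy0 hAt hlow hup hU0 hUB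
  /- ### the identity `Cov(W, N) = Σ_q w_q Cov_q` and the sum over `q` -/
  obtain ⟨W, hW⟩ : ∃ W : ℕ → ℝ, W = fun n : ℕ => ∑ i, ∑ q ∈ (Py).filter
      (fun q => q ∣ ((f i).eval (n : ℤ)).toNat ∧ ((f i).eval (n : ℤ)).toNat ≠ 0),
      (1 - 2 * ArithmeticFunction.vonMangoldt q / Real.log y) := ⟨_, rfl⟩
  have hWq : ∀ n, W n = ∑ q ∈ Py, (1 - 2 * ArithmeticFunction.vonMangoldt q / Real.log y) *
      ∑ i ∈ (univ : Finset (Fin k)), Zf (i, q) n := by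
    intro n
    have e : ∀ i : Fin k, ∑ q ∈ Py.filter
        (fun q => q ∣ ((f i).eval (n : ℤ)).toNat ∧ ((f i).eval (n : ℤ)).toNat ≠ 0),
          (1 - 2 * ArithmeticFunction.vonMangoldt q / Real.log y) =
        ∑ q ∈ Py, (1 - 2 * ArithmeticFunction.vonMangoldt q / Real.log y) * Zf (i, q) n := by
      intro i
      rw [sum_filter]
      refine sum_congr rfl fun q _ => ?_
      simp only [hZf, mul_ite, mul_one, mul_zero]
    rw [hW]
    simp only [e]
    rw [sum_comm]
    refine sum_congr rfl fun q _ => ?_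
    rw [mul_sum]
  have hmain : (∑ n ∈ range (x + 1), W n * N n) / ((x : ℝ) + 1) -
      (∑ n ∈ range (x + 1), W n) / ((x : ℝ) + 1) * ((∑ n ∈ range (x + 1), N n) / ((x : ℝ) + 1)) =
      ∑ q ∈ Py, (1 - 2 * ArithmeticFunction.vonMangoldt q / Real.log y) * cov q := by
    simp_rw [hWq]
    rw [hcov]
    exact weightedCov_expand (univ : Finset (Fin k)) Py (range (x + 1))
      (fun q => 1 - 2 * ArithmeticFunction.vonMangoldt q / Real.log y) (fun i q n => Zf (i, q) n)
      N ((x : ℝ) + 1)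
  have hsum : -(3 * |C| + 24 * k * K * D) ≤
      ∑ q ∈ Py, (1 - 2 * ArithmeticFunction.vonMangoldt q / Real.log y) * cov q := by
    have h1 : -((|C| / Real.log x + 4 * k * K * D / Real.log y) *
        ∑ q ∈ Py, ArithmeticFunction.vonMangoldt q / (q : ℝ)) ≤
        ∑ q ∈ Py, (1 - 2 * ArithmeticFunction.vonMangoldt q / Real.log y) * cov q := by
      have e : (|C| / Real.log x + 4 * k * K * D / Real.log y) *
          ∑ q ∈ Py, ArithmeticFunction.vonMangoldt q / (q : ℝ) =
          ∑ q ∈ Py, (|C| / Real.log x * (ArithmeticFunction.vonMangoldt q / (q : ℝ)) +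
            4 * k * K * D / Real.log y * (ArithmeticFunction.vonMangoldt q / (q : ℝ))) := by
        rw [mul_sum]
        exact sum_congr rfl fun q _ => by ring
      rw [e, ← sum_neg_distrib]
      exact sum_le_sum hterm
    have hA0 : 0 ≤ |C| / Real.log x := by positivity
    have hB0 : 0 ≤ 4 * k * K * D / Real.log y := div_nonneg (by linarith) hlogy0.le
    have h2 : (|C| / Real.log x + 4 * k * K * D / Real.log y) *
        ∑ q ∈ Py, ArithmeticFunction.vonMangoldt q / (q : ℝ) ≤
        (|C| / Real.log x + 4 * k * K * D / Real.log y) * (2 * Real.log y + 2) :=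
      mul_le_mul_of_nonneg_left hsum3 (add_nonneg hA0 hB0)
    -- `(|C|/log x)(2 log y + 2) ≤ 3|C|`, `(4kKD/log y)(2 log y + 2) ≤ 24 kKD`
    have h3 : |C| / Real.log x * (2 * Real.log y + 2) ≤ 3 * |C| := by
      rw [div_mul_eq_mul_div, div_le_iff₀ hlogx0]
      have h0 := abs_nonneg C
      have e : 3 * |C| * Real.log x = |C| * (2 * Real.log x + Real.log x) := by ring
      rw [e]
      exact mul_le_mul_of_nonneg_left (by linarith) h0
    have h4 : 4 * k * K * D / Real.log y * (2 * Real.log y + 2) ≤ 24 * k * K * D := by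
      rw [div_mul_eq_mul_div, div_le_iff₀ hlogy0]
      have h0 : (0 : ℝ) ≤ 4 * k * K * D := by linarith
      have e : 24 * k * K * D * Real.log y = 4 * k * K * D * (6 * Real.log y) := by ring
      rw [e]
      exact mul_le_mul_of_nonneg_left (by linarith) h0
    have e : (|C| / Real.log x + 4 * k * K * D / Real.log y) * (2 * Real.log y + 2) =
        |C| / Real.log x * (2 * Real.log y + 2) +
          4 * k * K * D / Real.log y * (2 * Real.log y + 2) := by ring
    rw [e] at h2
    linarith
  -- conclusion: back to the verbatim statement
  have key : -(3 * |C| + 24 * k * K * D) ≤ (∑ n ∈ range (x + 1), W n * N n) / ((x : ℝ) + 1) -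
      (∑ n ∈ range (x + 1), W n) / ((x : ℝ) + 1) * ((∑ n ∈ range (x + 1), N n) / ((x : ℝ) + 1)) := by
    rw [hmain]; exact hsum
  rw [hW, hN] at key
  exact key

end Summit.Parity.BatemanHorn.Cruxes.SystemMomentDeficit.Ideator3Sketch
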